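import Summits.Ventures.HodgeRepro2.T5DoubleCosetDecomposition
import Summits.Ventures.HodgeRepro2.T5AdmissibilityBookkeeping
import Summits.Ventures.HodgeRepro2.T5CompactOpenOrbits
import Mathlib.Topology.Algebra.Group.Basic
import Mathlib.Topology.Algebra.ConstMulAction
import Mathlib.Topology.Homeomorph.Lemmas

/-!
# T5DoubleCosetTopology — (A3) STEP 1: the topology of `G(F)\G(𝔸)/K_f` and its `G_∞`-orbits

Cell pub-hodge-repro2, seat p5, Tier 5 (route/T5-N4-p5.md, N4.3 (A3) STEP 1, l. 147).  The
printed sentences kernel-checked here are the TOPOLOGICAL ones that p2's algebraic decomposition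
`T5DoubleCosetDecomposition.decomposition : (Σ q, Component H K q) ≃ FullQuotient H K`
(«[G]/K_f = ⊔_i Γ_i\G_∞») leaves to prose:

* «each orbit is open (the image of the open set `G_∞ g K_f` under the open quotient map)» —
  `isOpenMap_mk` (the quotient map `G → H\G/K` of ANY topological group is open: the saturation
  of an open set is the union of its translates `h·U·k`, `preimage_mk_image`) and
  `isOpen_range_toFull` / `isOpen_orbit` (for `K` open in `G(𝔸_f)`);
* «the map `G_∞ → Y`, `g_∞ ↦ [g_∞ g_i]` identifies the `i`-th orbit with `Γ_i\G_∞`,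
  `Γ_i := G(F) ∩ g_i K_f g_i⁻¹`: `γ g_∞ g_i k = g′_∞ g_i` with `γ ∈ G(F)`, `k ∈ K_f` forces
  `γ ∈ Γ_i` at the finite places and `g′_∞ = γ_∞ g_∞`» — the right action of `A = G_∞` on
  `FullQuotient H K = H\(A × B)/({1} × K)` (`instMulAction`, `a • [x] = [x·(a⁻¹, 1)]`), its
  orbits `orbit_eq_preimage_finitePart` / `orbit_mk_eq_range_toFull` (the orbit of `[(1, g_i)]`
  IS p2's component `range (toFull q)`), its stabilisers `stabilizer_mk_eq_gammaGroup`
  (Mathlib's `MulAction.stabilizer A [(1, g)]` = p2's `gammaGroup H K g` — the printed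
  computation), and the HOMEOMORPHISM `componentHomeomorph : Component H K q ≃ₜ range (toFull q)`
  (`toFull q` is a continuous open injection: `continuous_toFull` / `isOpenMap_toFull`);
* «`Γ_i` is … cocompact since `Γ_i\G_∞ ≅` the compact `i`-th orbit» and «so there are finitely
  many» — for a COMPACT `FullQuotient H K` (the prose's «[G] compact since `W_A` is anisotropic»):
  `compactSpace_component` and `finite_finiteQuotient` (`Finite (FiniteQuotient H K)`, i.e.
  `h < ∞` from compactness alone, via
  `T5AdmissibilityBookkeeping.finite_of_pairwise_disjoint_open_cover`; no class-number theorem),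
  plus the dictionary to row 26 (`finite_orbitRel_quotient`, `isCompact_orbit`).

Setting: `A`, `B` topological groups, `H ≤ A × B` (= `G(F)` diagonally), `K ≤ B` (= `K_f`), the
quotient topology on every `DoubleCoset.Quotient` (`instTopologicalSpace`).  Nothing about adeles,
unitary groups or measures is asserted; the objects are p2's.  Mathlib only besides the cell's own
files.  Axioms: propext, Classical.choice, Quot.sound.  README §8(d): uses an L-value-free
non-vanishing device: NO.
-/

namespace Summit.Ventures.HodgeRepro2.T5DoubleCosetTopology

open Summit.Ventures.HodgeRepro2.T5DoubleCosetDecomposition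
open Topology

/-! ### The quotient topology on `H\G/K` -/

section General

variable {G : Type*} [Group G]

/-- The saturation of a set `U ⊆ G` under the double coset relation is the union of its
translates `h · U · k`, `h ∈ H`, `k ∈ K`. -/
theorem preimage_mk_image (H K : Subgroup G) (U : Set G) :
    DoubleCoset.mk H K ⁻¹' (DoubleCoset.mk H K '' U) =
      ⋃ h ∈ H, ⋃ k ∈ K, (fun x => h * x * k) '' U := by
  ext x
  simp only [Set.mem_preimage, Set.mem_image, Set.mem_iUnion, exists_prop]
  constructor
  · rintro ⟨u, hu, hux⟩
    obtain ⟨h, hh, k, hk, rfl⟩ := (DoubleCoset.eq H K u x).1 hux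
    exact ⟨h, hh, k, hk, u, hu, rfl⟩
  · rintro ⟨h, hh, k, hk, u, hu, rfl⟩
    exact ⟨u, hu, (DoubleCoset.eq H K u _).2 ⟨h, hh, k, hk, rfl⟩⟩

variable [TopologicalSpace G]

/-- The quotient topology on the double coset space `H\G/K`. -/
instance instTopologicalSpace (H K : Set G) : TopologicalSpace (DoubleCoset.Quotient H K) :=
  inferInstanceAs (TopologicalSpace (_root_.Quotient (DoubleCoset.setoid H K)))

/-- The quotient map `G → H\G/K` is a quotient map. -/
theorem isQuotientMap_mk (H K : Subgroup G) : IsQuotientMap (DoubleCoset.mk H K) :=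
  isQuotientMap_quotient_mk'

/-- The quotient map `G → H\G/K` is continuous. -/
theorem continuous_mk (H K : Subgroup G) : Continuous (DoubleCoset.mk H K) :=
  (isQuotientMap_mk H K).continuous

/-- **The quotient map `G → H\G/K` is open** («the open quotient map» of STEP 1): the saturation
of an open set is a union of translates, each open. -/
theorem isOpenMap_mk [ContinuousMul G] (H K : Subgroup G) : IsOpenMap (DoubleCoset.mk H K) := by
  intro U hU
  rw [← (isQuotientMap_mk H K).isCoinducing.isOpen_preimage, preimage_mk_image]
  exact isOpen_iUnion fun h => isOpen_iUnion fun _ => isOpen_iUnion fun k =>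
    isOpen_iUnion fun _ => (isOpenMap_mul_right k).comp (isOpenMap_mul_left h) U hU

/-- The quotient map `G → H\G/K` is an open quotient map. -/
theorem isOpenQuotientMap_mk [ContinuousMul G] (H K : Subgroup G) :
    IsOpenQuotientMap (DoubleCoset.mk H K) :=
  ⟨(isQuotientMap_mk H K).surjective, continuous_mk H K, isOpenMap_mk H K⟩

end General

/-! ### The right action of `A = G_∞` on `FullQuotient H K = H\(A × B)/({1} × K)` -/

section Product

variable {A B : Type*} [Group A] [Group B]
variable (H : Subgroup (A × B)) (K : Subgroup B)

/-- An element of `{1} × K` commutes with every element of `A × {1}`. -/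
theorem rightLevel_mul_inl {k : A × B} (hk : k ∈ rightLevel A K) (a : A) :
    k * MonoidHom.inl A B a = MonoidHom.inl A B a * k := by
  obtain ⟨hk1, -⟩ := mem_rightLevel.1 hk
  ext
  · rw [Prod.fst_mul, Prod.fst_mul, MonoidHom.inl_apply, hk1, one_mul, mul_one]
  · rw [Prod.snd_mul, Prod.snd_mul, MonoidHom.inl_apply, mul_one, one_mul]

/-- The right action of `A` on `H\(A × B)/({1} × K)`: `a • [x] = [x · (a⁻¹, 1)]`
(right multiplication by `A × {1}` commutes with the left `H`-action and with the right
`{1} × K`-action). -/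
instance instMulAction : MulAction A (FullQuotient H K) where
  smul a t := Quotient.liftOn' t
    (fun p => DoubleCoset.mk H (rightLevel A K) (p * MonoidHom.inl A B a⁻¹))
    (by
      intro p p' hpp'
      obtain ⟨h, hh, k, hk, rfl⟩ := DoubleCoset.rel_iff.1 hpp'
      refine (DoubleCoset.eq _ _ _ _).2 ⟨h, hh, k, hk, ?_⟩
      simp only [mul_assoc]
      rw [rightLevel_mul_inl K hk])
  one_smul t := by
    refine Quotient.inductionOn' t fun p => ?_
    show DoubleCoset.mk H (rightLevel A K) (p * MonoidHom.inl A B (1 : A)⁻¹) =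
      DoubleCoset.mk H (rightLevel A K) p
    rw [inv_one, map_one, mul_one]
  mul_smul a b t := by
    refine Quotient.inductionOn' t fun p => ?_
    show DoubleCoset.mk H (rightLevel A K) (p * MonoidHom.inl A B (a * b)⁻¹) =
      DoubleCoset.mk H (rightLevel A K) (p * MonoidHom.inl A B b⁻¹ * MonoidHom.inl A B a⁻¹)
    rw [mul_inv_rev, map_mul, mul_assoc]

/-- The action on representatives. -/
theorem smul_mk (a : A) (p : A × B) :
    a • DoubleCoset.mk H (rightLevel A K) p =
      DoubleCoset.mk H (rightLevel A K) (p * MonoidHom.inl A B a⁻¹) := rfl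

/-- The finite part `[x₂] ∈ H_B\B/K` of a double coset is `A`-invariant. -/
theorem finitePart_smul (a : A) (t : FullQuotient H K) : finitePart (a • t) = finitePart t := by
  refine Quotient.inductionOn' t fun p => ?_
  rw [smul_mk, finitePart_mk, finitePart_mk]
  simp only [Prod.snd_mul, MonoidHom.inl_apply, mul_one]

/-- The `A`-orbit of `[x]` is the fibre of `finitePart` over `[x₂]`: «each orbit is
`G(F)\G(F) G_∞ g_i K_f/K_f`». -/
theorem orbit_eq_preimage_finitePart (t : FullQuotient H K) :
    MulAction.orbit A t = finitePart ⁻¹' {finitePart t} := by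
  ext s
  rw [MulAction.mem_orbit_iff, Set.mem_preimage, Set.mem_singleton_iff]
  refine ⟨?_, ?_⟩
  · rintro ⟨a, rfl⟩
    exact finitePart_smul H K a t
  · refine Quotient.inductionOn' t fun p => Quotient.inductionOn' s fun p' hps => ?_
    rw [finitePart_mk, finitePart_mk] at hps
    obtain ⟨y, hy, k, hk, hp⟩ := (DoubleCoset.eq _ _ _ _).1 hps
    obtain ⟨h, hh, rfl⟩ := mem_imageSnd.1 hy
    refine ⟨p'.1⁻¹ * h.1⁻¹ * p.1, ?_⟩
    rw [smul_mk]
    refine (DoubleCoset.eq _ _ _ _).2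
      ⟨h⁻¹, H.inv_mem hh, (1, k⁻¹), mem_rightLevel.2 ⟨rfl, K.inv_mem hk⟩, ?_⟩
    ext
    · simp only [Prod.fst_mul, Prod.fst_inv, MonoidHom.inl_apply]
      group
    · simp only [Prod.snd_mul, Prod.snd_inv, MonoidHom.inl_apply]
      rw [hp]
      group

/-- «The map `G_∞ → Y`, `g_∞ ↦ [g_∞ g_i]`, identifies the `i`-th orbit»: the `A`-orbit of
`[(1, g_q)]` is p2's component `range (toFull q)`. -/
theorem orbit_mk_eq_range_toFull (q : FiniteQuotient H K) :
    MulAction.orbit A (DoubleCoset.mk H (rightLevel A K) (1, rep q)) = Set.range (toFull q) := by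
  rw [orbit_eq_preimage_finitePart, range_toFull, finitePart_mk, mk_rep]

/-- «`γ g_∞ g_i k = g′_∞ g_i` with `γ ∈ G(F)`, `k ∈ K_f` forces `γ ∈ Γ_i` at the finite places
and `g′_∞ = γ_∞ g_∞`»: the stabiliser in `A` of `[(1, g)]` is `Γ_g = gammaGroup H K g`
(p2's `{γ_A : γ ∈ H, γ_B ∈ g K g⁻¹}`). -/
theorem stabilizer_mk_eq_gammaGroup (g : B) :
    MulAction.stabilizer A (DoubleCoset.mk H (rightLevel A K) (1, g)) = gammaGroup H K g := by
  ext a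
  rw [MulAction.mem_stabilizer_iff, smul_mk, DoubleCoset.eq, mem_gammaGroup]
  constructor
  · rintro ⟨h, hh, k, hk, hgk⟩
    obtain ⟨hk1, hk2⟩ := mem_rightLevel.1 hk
    have h1 : (1 : A) = h.1 * a⁻¹ := by
      have := congrArg Prod.fst hgk
      simp only [Prod.fst_mul, MonoidHom.inl_apply, hk1, one_mul, mul_one] at this
      exact this
    have h2 : g = h.2 * g * k.2 := by
      have := congrArg Prod.snd hgk
      simp only [Prod.snd_mul, MonoidHom.inl_apply, mul_one] at this
      exact this
    refine ⟨h, hh, mul_inv_eq_one.1 h1.symm, k.2⁻¹, K.inv_mem hk2, ?_⟩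
    calc h.2 = h.2 * g * k.2 * k.2⁻¹ * g⁻¹ := by group
      _ = g * k.2⁻¹ * g⁻¹ := by rw [← h2]
  · rintro ⟨h, hh, rfl, k, hk, hk2⟩
    refine ⟨h, hh, (1, k⁻¹), mem_rightLevel.2 ⟨rfl, K.inv_mem hk⟩, ?_⟩
    ext
    · simp only [Prod.fst_mul, MonoidHom.inl_apply]
      group
    · simp only [Prod.snd_mul, MonoidHom.inl_apply, hk2]
      group

/-- Mathlib's orbit–stabiliser bijection for the orbit of `[(1, g_q)]`:
`range (toFull q) ≃ A ⧸ stabilizer`, with the stabiliser computed by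
`stabilizer_mk_eq_gammaGroup` (left cosets here; p2's `Component` uses right cosets). -/
noncomputable def rangeToFullEquivQuotientStabilizer (q : FiniteQuotient H K) :
    Set.range (toFull q) ≃
      A ⧸ MulAction.stabilizer A (DoubleCoset.mk H (rightLevel A K) (1, rep q)) :=
  (Equiv.setCongr (orbit_mk_eq_range_toFull H K q)).symm.trans
    (MulAction.orbitEquivQuotientStabilizer A _)

/-- The component `range (toFull q)` is the image of `A × g_q K` under the quotient map. -/
theorem range_toFull_eq_image (q : FiniteQuotient H K) :
    Set.range (toFull q) = DoubleCoset.mk H (rightLevel A K) ''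
      (Set.univ ×ˢ ((fun k => rep q * k) '' (K : Set B))) := by
  ext t
  constructor
  · rintro ⟨x, rfl⟩
    refine Quotient.inductionOn' x fun a => ?_
    exact ⟨(a, rep q), ⟨Set.mem_univ _, 1, K.one_mem, mul_one _⟩, (toFull_mk q a).symm⟩
  · rintro ⟨⟨a, b⟩, ⟨-, k, hk, rfl⟩, rfl⟩
    refine ⟨Quotient.mk'' a, ?_⟩
    rw [toFull_mk]
    exact (DoubleCoset.eq _ _ _ _).2 ⟨1, H.one_mem, (1, k), mem_rightLevel.2 ⟨rfl, hk⟩, by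
      rw [one_mul, Prod.mk_mul_mk, mul_one]⟩

/-! ### Topology: open components, the homeomorphism `Γ_q\A ≃ₜ range (toFull q)`, compactness -/

section Topology

variable [TopologicalSpace A] [TopologicalSpace B]

/-- «The map `G_∞ → Y`, `g_∞ ↦ [g_∞ g_i]`» is continuous. -/
theorem continuous_smul_const [IsTopologicalGroup A] [ContinuousMul B] (t : FullQuotient H K) :
    Continuous fun a : A => a • t := by
  refine Quotient.inductionOn' t fun p => ?_
  show Continuous fun a : A => DoubleCoset.mk H (rightLevel A K) (p * ((a⁻¹ : A), (1 : B)))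
  exact (continuous_mk _ _).comp (by fun_prop)

/-- Every `t ↦ a • t` is continuous. -/
instance instContinuousConstSMul [IsTopologicalGroup A] [ContinuousMul B] :
    ContinuousConstSMul A (FullQuotient H K) where
  continuous_const_smul := fun _ =>
    Continuous.quotient_liftOn' ((continuous_mk _ _).comp (continuous_id.mul continuous_const)) _

/-- **«each orbit is open (the image of the open set `G_∞ g K_f` under the open quotient map)»**,
component form: for `K` open, every component `range (toFull q)` is open. -/
theorem isOpen_range_toFull [ContinuousMul A] [ContinuousMul B] (hK : IsOpen (K : Set B))
    (q : FiniteQuotient H K) : IsOpen (Set.range (toFull q)) := by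
  rw [range_toFull_eq_image]
  exact isOpenMap_mk H (rightLevel A K) _ (isOpen_univ.prod (isOpenMap_mul_left (rep q) _ hK))

/-- **«each orbit is open»**, orbit form: for `K` open, every `A`-orbit in `FullQuotient H K` is
open. -/
theorem isOpen_orbit [ContinuousMul A] [ContinuousMul B] (hK : IsOpen (K : Set B))
    (t : FullQuotient H K) : IsOpen (MulAction.orbit A t) := by
  rw [orbit_eq_preimage_finitePart, ← range_toFull]
  exact isOpen_range_toFull H K hK _

/-- «each orbit is closed (complement of … open orbits)»: for `K` open, every component is
closed (its complement is the union of the other components). -/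
theorem isClosed_range_toFull [ContinuousMul A] [ContinuousMul B] (hK : IsOpen (K : Set B))
    (q : FiniteQuotient H K) : IsClosed (Set.range (toFull q)) :=
  T5AdmissibilityBookkeeping.isClosed_of_pairwise_disjoint_open_cover
    (fun q => Set.range (toFull q)) (isOpen_range_toFull H K hK)
    pairwise_disjoint_range_toFull iUnion_range_toFull q

/-- `toFull q : Γ_q\A → H\(A × B)/({1} × K)` is continuous. -/
theorem continuous_toFull (q : FiniteQuotient H K) : Continuous (toFull q) :=
  Continuous.quotient_liftOn' ((continuous_mk _ _).comp (continuous_id.prodMk continuous_const)) _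

/-- For `K` open, `toFull q : Γ_q\A → H\(A × B)/({1} × K)` is an open map: the image of an
open set `U ⊆ Γ_q\A` is the image of the open set `Ũ × g_q K` under the open quotient map. -/
theorem isOpenMap_toFull [ContinuousMul A] [ContinuousMul B] (hK : IsOpen (K : Set B))
    (q : FiniteQuotient H K) : IsOpenMap (toFull q) := by
  intro U hU
  have hV : IsOpen ((Quotient.mk'' : A → Component H K q) ⁻¹' U) :=
    continuous_quotient_mk'.isOpen_preimage U hU
  have himage : toFull q '' U = DoubleCoset.mk H (rightLevel A K) ''
      (((Quotient.mk'' : A → Component H K q) ⁻¹' U) ×ˢ ((fun k => rep q * k) '' (K : Set B))) := by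
    ext t
    constructor
    · rintro ⟨x, hx, rfl⟩
      revert hx
      refine Quotient.inductionOn' x fun a ha => ?_
      exact ⟨(a, rep q), ⟨ha, 1, K.one_mem, mul_one _⟩, (toFull_mk q a).symm⟩
    · rintro ⟨⟨a, b⟩, ⟨ha, k, hk, rfl⟩, rfl⟩
      refine ⟨Quotient.mk'' a, ha, ?_⟩
      rw [toFull_mk]
      exact (DoubleCoset.eq _ _ _ _).2 ⟨1, H.one_mem, (1, k), mem_rightLevel.2 ⟨rfl, hk⟩, by
        rw [one_mul, Prod.mk_mul_mk, mul_one]⟩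
  rw [himage]
  exact isOpenMap_mk H (rightLevel A K) _ (hV.prod (isOpenMap_mul_left (rep q) _ hK))

/-- `Component H K q ≃ range (toFull q)`, the bijection underlying p2's `decomposition`. -/
noncomputable def componentEquiv (q : FiniteQuotient H K) :
    Component H K q ≃ Set.range (toFull q) :=
  Equiv.ofInjective (toFull q) fun _ _ h => toFull_inj q h

/-- **«identifies the `i`-th orbit with `Γ_i\G_∞`»**: for `K` open, `toFull q` is a
homeomorphism of `Γ_q\A` onto the component `range (toFull q)` (a continuous open bijection). -/
noncomputable def componentHomeomorph [ContinuousMul A] [ContinuousMul B]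
    (hK : IsOpen (K : Set B)) (q : FiniteQuotient H K) :
    Component H K q ≃ₜ Set.range (toFull q) :=
  (componentEquiv H K q).toHomeomorphOfContinuousOpen
    (by
      show Continuous fun x => (⟨toFull q x, x, rfl⟩ : Set.range (toFull q))
      exact (continuous_toFull H K q).subtype_mk _)
    (by
      show IsOpenMap fun x => (⟨toFull q x, x, rfl⟩ : Set.range (toFull q))
      exact (isOpenMap_toFull H K hK q).subtype_mk _)

/-- The homeomorphism is `toFull q` on points. -/
theorem componentHomeomorph_apply_coe [ContinuousMul A] [ContinuousMul B]
    (hK : IsOpen (K : Set B)) (q : FiniteQuotient H K) (x : Component H K q) :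
    (componentHomeomorph H K hK q x : FullQuotient H K) = toFull q x := rfl

/-- For a compact `FullQuotient H K` («[G] compact») and `K` open, each component is compact. -/
theorem isCompact_range_toFull [ContinuousMul A] [ContinuousMul B]
    [CompactSpace (FullQuotient H K)] (hK : IsOpen (K : Set B)) (q : FiniteQuotient H K) :
    IsCompact (Set.range (toFull q)) :=
  (isClosed_range_toFull H K hK q).isCompact

/-- **«`Γ_i` is … cocompact since `Γ_i\G_∞ ≅` the compact `i`-th orbit»**: for a compact
`FullQuotient H K` and `K` open, every `Γ_q\A = Component H K q` is compact. -/
theorem compactSpace_component [ContinuousMul A] [ContinuousMul B]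
    [CompactSpace (FullQuotient H K)] (hK : IsOpen (K : Set B)) (q : FiniteQuotient H K) :
    CompactSpace (Component H K q) :=
  haveI : CompactSpace (Set.range (toFull q)) :=
    isCompact_iff_compactSpace.1 (isCompact_range_toFull H K hK q)
  (componentHomeomorph H K hK q).symm.compactSpace

/-- **«so there are finitely many»**: for a compact `FullQuotient H K` and `K` open, the index
set `H_B\B/K` of the components is finite — `h < ∞` from compactness alone (row 10's
`finite_of_pairwise_disjoint_open_cover`; no class-number theorem).  This is p2's «STAYS PROSE:
the finiteness of `G(F⁺)\G(𝔸_f)/K`» in the compact case. -/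
theorem finite_finiteQuotient [ContinuousMul A] [ContinuousMul B]
    [CompactSpace (FullQuotient H K)] (hK : IsOpen (K : Set B)) :
    Finite (FiniteQuotient H K) :=
  T5AdmissibilityBookkeeping.finite_of_pairwise_disjoint_open_cover
    (fun q => Set.range (toFull q)) (isOpen_range_toFull H K hK)
    (fun q => ⟨toFull q (Quotient.mk'' 1), Quotient.mk'' 1, rfl⟩)
    pairwise_disjoint_range_toFull iUnion_range_toFull

/-- Dictionary to row 26 (`T5CompactOpenOrbits`): finitely many `A`-orbits on a compact
`FullQuotient H K`. -/
theorem finite_orbitRel_quotient [ContinuousMul A] [ContinuousMul B]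
    [CompactSpace (FullQuotient H K)] (hK : IsOpen (K : Set B)) :
    Finite (MulAction.orbitRel.Quotient A (FullQuotient H K)) :=
  T5CompactOpenOrbits.finite_orbitRel_quotient (isOpen_orbit H K hK)

/-- Dictionary to row 26 (`T5CompactOpenOrbits`): every `A`-orbit of a compact
`FullQuotient H K` is compact. -/
theorem isCompact_orbit [ContinuousMul A] [ContinuousMul B] [CompactSpace (FullQuotient H K)]
    (hK : IsOpen (K : Set B)) (t : FullQuotient H K) : IsCompact (MulAction.orbit A t) :=
  T5CompactOpenOrbits.isCompact_orbit (isOpen_orbit H K hK) t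

end Topology

end Product

end Summit.Ventures.HodgeRepro2.T5DoubleCosetTopology
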